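import Literature.NumberTheory.Sieve.GreenTao2006Restriction
import Literature.NumberTheory.Sieve.GreenTao2006EnvelopingSieveBounds
import Literature.NumberTheory.Sieve.GreenTao2006RestrictionEstimate
import Literature.NumberTheory.Sieve.GreenTao2006RestrictionDuality
import HarnessLib

/-!
# Green–Tao (2006), Prop. 3.1 (i) + Prop. 4.2 for monic tuples: proof of the named fact

B. Green, T. Tao, *Restriction theory of the Selberg sieve, with applications*, JTNB **18** (2006)
[GreenTao2006Restriction].  This file discharges the named fact
`Literature.NumberTheory.Sieve.GreenTao2006_envelopingSieve_extension` (`GreenTao2006Restriction.lean`)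
by assembling the five proved layers

* `GreenTao2006EnvelopingSieve.lean`, `…Fourier.lean`, `…Bounds.lean` — the Ramaré–Ruzsa /
  Green–Tao enveloping sieve `β_R = α_R²/G(R)` for `F(n) = ∏_{h∈H}(n+h)`, its Fourier expansion
  with coefficients `≪ q^{ε-1}`, the bounds `G(R) ≫_k (log R)^k/𝔖(H)` (Prop. 3.1 (i)) and the
  moment bound for `β := β_R · 1[F(n) ≠ 0]`;
* `GreenTao2006RestrictionEstimate.lean` — the set estimate (4.2) of Prop. 4.1 (Bourgain's
  argument);
* `GreenTao2006RestrictionDuality.lean` — dyadic pigeonhole, duality and integration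
  (Prop. 4.1 ⇒ Prop. 4.2).

The sieve used is `β = β_R · 1[F(n) ≠ 0]`, which agrees with GT's `β_R` except at the `≤ k`
roots of `F` in `[1, N]` (where GT's (ii) fails and (4.8) can fail for `p` near `2`); these
points are not in `X_{R!}`, so (i) is unaffected.  Parameters: `q = p/(p-1)`,
`ε = min(1/4, (2/q-1)/6)`, `s = ⌈1/ε⌉`, `Q = R²`, `R₀ = max(R₁(k), 3)`, `N₀ = N₀(k, p)`.

## References

* [GreenTao2006Restriction] Green–Tao, JTNB 18 (2006), Prop. 3.1, Prop. 4.1, Prop. 4.2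
  (arXiv:math/0405581).
-/

noncomputable section

open Finset Real Complex MeasureTheory
open scoped FourierTransform ComplexConjugate

namespace Literature.NumberTheory.Sieve

namespace GreenTao2006

open LargeSieve (e e_add e_int norm_e)

/-! ### Numerology of the moment constant -/

/-- The moment constant `M(R) = 4k exp(a (log log R + 4))`, `a = 4k²s + 2^{2sk} - 1`, is `≥ 1`
for `R ≥ 3`. [folklore] -/
theorem one_le_moment_const {k R : ℕ} (hk : 1 ≤ k) (hR : 3 ≤ R) (a : ℝ) (ha : 0 ≤ a) :
    1 ≤ 4 * (k : ℝ) * Real.exp (a * (Real.log (Real.log R) + 4)) := by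
  have hk1 : (1 : ℝ) ≤ k := by exact_mod_cast hk
  have hR3 : (3 : ℝ) ≤ R := by exact_mod_cast hR
  have hlog : 1 ≤ Real.log R := by
    rw [← Real.log_exp 1]
    exact Real.log_le_log (Real.exp_pos 1) (by linarith [Real.exp_one_lt_d9])
  have hll : 0 ≤ Real.log (Real.log R) := Real.log_nonneg hlog
  have hexp : 1 ≤ Real.exp (a * (Real.log (Real.log R) + 4)) := Real.one_le_exp (by positivity)
  nlinarith

/-- For `N` large in terms of `k, s` and `3 ≤ R ≤ N`: `M(R)² ≤ N`
(`M(R)² ≤ 16k² e^{8a} (log N)^{2a}` and `(log N)^{2a+1} ≤ (2a+1)! N`). [folklore] -/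
theorem moment_const_sq_le (k s : ℕ) (hk : 1 ≤ k) :
    ∃ N₀ : ℕ, ∀ N R : ℕ, N₀ ≤ N → 3 ≤ R → R ≤ N →
      (4 * (k : ℝ) * Real.exp (((4 * k ^ 2 * s + (2 ^ (2 * s * k) - 1) : ℕ) : ℝ) *
        (Real.log (Real.log R) + 4))) ^ 2 ≤ N := by
  set a : ℕ := 4 * k ^ 2 * s + (2 ^ (2 * s * k) - 1) with ha
  set Λ₀ : ℝ := 16 * (k : ℝ) ^ 2 * Real.exp (8 * a) * (2 * a + 1).factorial with hΛ₀
  refine ⟨max 3 ⌈Real.exp Λ₀⌉₊, fun N R hN hR hRN => ?_⟩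
  have hN3 : (3 : ℝ) ≤ N := by exact_mod_cast (le_max_left _ _).trans hN
  have hN0 : (0 : ℝ) < N := by linarith
  have hR3 : (3 : ℝ) ≤ R := by exact_mod_cast hR
  have hRN' : (R : ℝ) ≤ N := by exact_mod_cast hRN
  have hlogN : Λ₀ ≤ Real.log N := by
    have h1 : Real.exp Λ₀ ≤ N := (Nat.le_ceil _).trans (by exact_mod_cast (le_max_right _ _).trans hN)
    have := Real.log_le_log (Real.exp_pos _) h1
    rwa [Real.log_exp] at this
  have hk0 : (0 : ℝ) < k := by exact_mod_cast hk
  have hΛ₀0 : 0 < Λ₀ := by rw [hΛ₀]; positivity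
  have hlogN0 : 0 < Real.log N := lt_of_lt_of_le hΛ₀0 hlogN
  have hlogR1 : 1 ≤ Real.log R := by
    rw [← Real.log_exp 1]
    exact Real.log_le_log (Real.exp_pos 1) (by linarith [Real.exp_one_lt_d9])
  -- `log log R ≤ log log N`
  have hll : Real.log (Real.log R) ≤ Real.log (Real.log N) :=
    Real.log_le_log (by linarith) (Real.log_le_log (by linarith) hRN')
  have hllN : Real.exp (Real.log (Real.log N)) = Real.log N := Real.exp_log hlogN0
  -- the square of the constant
  calc (4 * (k : ℝ) * Real.exp ((a : ℝ) * (Real.log (Real.log R) + 4))) ^ 2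
      ≤ (4 * (k : ℝ) * Real.exp ((a : ℝ) * (Real.log (Real.log N) + 4))) ^ 2 := by
        gcongr
    _ = 16 * (k : ℝ) ^ 2 * Real.exp (8 * a) * Real.log N ^ (2 * a) := by
        rw [mul_pow, mul_pow, ← Real.exp_nat_mul, show ((2 : ℕ) : ℝ) * ((a : ℝ) * (Real.log (Real.log N) + 4)) =
          8 * a + ((2 * a : ℕ) : ℝ) * Real.log (Real.log N) by push_cast; ring, Real.exp_add,
          Real.exp_nat_mul, hllN]
        norm_num; ring
    _ ≤ 16 * (k : ℝ) ^ 2 * Real.exp (8 * a) * ((2 * a + 1).factorial * N / Real.log N) := by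
        gcongr
        rw [le_div_iff₀ hlogN0, ← pow_succ]
        have := Real.pow_div_factorial_le_exp (Real.log N) hlogN0.le (2 * a + 1)
        rw [Real.exp_log hN0, div_le_iff₀ (by positivity)] at this
        linarith
    _ = (Λ₀ / Real.log N) * N := by rw [hΛ₀]; field_simp
    _ ≤ 1 * N := by
        refine mul_le_mul_of_nonneg_right ?_ hN0.le
        rw [div_le_one hlogN0]; exact hlogN
    _ = N := one_mul _


/-! ### The `L^p` bound for `β = β_R · 1[F ≠ 0]` from the set estimate -/

open Classical in
/-- **Prop. 4.2 (second display) for the sieve `β = β_R · 1[F(n) ≠ 0]`**, given the abstract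
set estimate with constant `C` at the exponent `ε`: for `H` admissible with `|H| = k ≥ 1`,
`|h| ≤ N`, `R ≥ 3`, `R⁴ ≤ N`, `N ≥ 16`, `M(R)² ≤ N`, dual exponents `(p-1)q = p` (`q ≥ 1`) with
`q(1+3ε) < 2`, `εs ≥ 1`, the `L^p(𝕋)` extension estimate holds with constant
`√(C A K²)`, `A = (32k²)^{⌊(32k²)^{1/ε}⌋+1}`, `K = 2^{c/2}/(1-2^{c/2-1})`, `c = q(1+3ε)`.
[cite: GreenTao2006Restriction, Prop. 4.2 (4.8)] -/
theorem lp_bound_beta {H : Finset ℤ} {k : ℕ} (hk : 1 ≤ k) (hcard : H.card = k)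
    (hadm : IsAdmissibleTuple H) {p q ε C : ℝ} (hp : 2 < p) (hpq : (p - 1) * q = p) (hq1 : 1 ≤ q)
    (hε : 0 < ε) (hqε : q * (1 + 3 * ε) < 2) {s : ℕ} (hs : 1 ≤ s) (hεs : 1 ≤ ε * s)
    (hC : 0 < C)
    (hset : ∀ {ι : Type} (T : Finset ι) (θ : ι → ℝ) (qd : ι → ℕ) (w : ι → ℂ)
      (A : ℝ) (Q : ℕ), 1 ≤ A → (∀ i ∈ T, 1 ≤ qd i ∧ qd i ≤ Q ∧ Squarefree (qd i)) →
      (∀ i ∈ T, ∃ a : ℤ, θ i = a / qd i) →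
      (∀ i ∈ T, ∀ j ∈ T, i ≠ j → ∀ m : ℤ, θ i - θ j ≠ m) →
      (∀ i ∈ T, ‖w i‖ ≤ A * (qd i : ℝ) ^ (ε - 1)) →
      ∀ (β₀ β : ℤ → ℝ), (∀ m : ℤ, (β₀ m : ℂ) = ∑ i ∈ T, w i * e (θ i * m)) → (∀ m, 0 ≤ β₀ m) →
      ∀ {N : ℕ} (s : ℕ) (Mm : ℝ), 16 ≤ N → Q ^ 2 ≤ N → 1 ≤ ε * s → 1 ≤ s → 1 ≤ Mm →
      Mm ^ 2 ≤ N → (∀ n ∈ Icc 1 N, 0 ≤ β n ∧ β n ≤ β₀ n) → (∑ n ∈ Icc 1 N, β n ^ s ≤ Mm * N) →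
      ∀ (B : Finset ℕ) (f : ℕ → ℂ), B ⊆ range N → (∀ b, ‖f b‖ ≤ 1) → (∀ b ∉ B, f b = 0) →
        ∑ n ∈ Icc 1 N, ‖∑ b ∈ range N, f b * e ((b : ℝ) * n / N)‖ ^ 2 * β n ≤
          C * A * N * (B.card : ℝ) ^ (1 + 3 * ε))
    {R N : ℕ} (hR : 3 ≤ R) (hRN : R ^ 4 ≤ N) (hN : 16 ≤ N) (hH : ∀ h ∈ H, |h| ≤ (N : ℤ))
    (hMm : (4 * (k : ℝ) * Real.exp (((4 * k ^ 2 * s + (2 ^ (2 * s * k) - 1) : ℕ) : ℝ) *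
        (Real.log (Real.log R) + 4))) ^ 2 ≤ N) (u : ℕ → ℂ) :
    (∫ θ in (0 : ℝ)..1, ‖(N : ℂ)⁻¹ * ∑ n ∈ Finset.Icc 1 N,
        u n * ((if ∃ h ∈ H, (n : ℤ) + h = 0 then 0 else betaR H R n : ℝ) : ℂ) *
          Complex.exp (2 * Real.pi * Complex.I * (n : ℂ) * (θ : ℂ))‖ ^ p) ^ (1 / p) ≤
      Real.sqrt (C * (32 * (k : ℝ) ^ 2) ^ (⌊(32 * (k : ℝ) ^ 2) ^ (1 / ε)⌋₊ + 1) *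
          (2 ^ (q * (1 + 3 * ε) / 2) / (1 - 2 ^ (q * (1 + 3 * ε) / 2 - 1))) ^ 2) *
        (N : ℝ) ^ (-(1 / p)) *
        ((N : ℝ)⁻¹ * ∑ n ∈ Finset.Icc 1 N,
          ‖u n‖ ^ 2 * (if ∃ h ∈ H, (n : ℤ) + h = 0 then 0 else betaR H R n)) ^ (1 / 2 : ℝ) := by
  -- basic sizes
  have hk' : 1 ≤ H.card := hcard ▸ hk
  have hR1 : 1 ≤ R := by omega
  have hR2 : 2 ≤ R := by omega
  have hN0 : 0 < N := by omega
  have hp1 : 1 < p := by linarith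
  have hp0 : 0 < p := by linarith
  have hq0 : 0 < q := by linarith
  -- the frequency data
  set T := (freqs R).filter (fun c => freqDen c ≤ R ^ 2) with hT
  set A : ℝ := (32 * (k : ℝ) ^ 2) ^ (⌊(32 * (k : ℝ) ^ 2) ^ (1 / ε)⌋₊ + 1) with hA
  have hL1 : (1 : ℝ) ≤ 32 * (k : ℝ) ^ 2 := by
    have : (1 : ℝ) ≤ k := by exact_mod_cast hk
    nlinarith
  have hA1 : 1 ≤ A := one_le_pow₀ hL1
  have hqd : ∀ c ∈ T, 1 ≤ freqDen c ∧ freqDen c ≤ R ^ 2 ∧ Squarefree (freqDen c) := fun c hc =>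
    ⟨one_le_freqDen c, (Finset.mem_filter.1 hc).2, squarefree_freqDen c⟩
  have hθ : ∀ c ∈ T, ∃ a : ℤ, freqVal c = a / freqDen c := by
    intro c _
    obtain ⟨a, ha⟩ := exists_freqVal_eq_div c
    exact ⟨a, by rw [ha]; push_cast; rfl⟩
  have hsep : ∀ c ∈ T, ∀ c' ∈ T, c ≠ c' → ∀ m : ℤ, freqVal c - freqVal c' ≠ m := fun c hc c' hc' hne m =>
    freqVal_sub_ne_intCast (Finset.mem_filter.1 hc).1 (Finset.mem_filter.1 hc').1 hne m
  have hw : ∀ c ∈ T, ‖betaCoeff H R c‖ ≤ A * (freqDen c : ℝ) ^ (ε - 1) := by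
    intro c _
    refine (norm_betaCoeff_le_div hadm hk' hR1 c).trans ?_
    rw [hcard, ← primeFactors_freqDen c, Real.rpow_sub_one (by exact_mod_cast (freqDen_pos c).ne')]
    rw [primeFactors_freqDen, ← mul_div_assoc]
    refine div_le_div_of_nonneg_right ?_ (Nat.cast_nonneg _)
    have := pow_card_le_mul_rpow hL1 hε (freqSupp c) fun p hp => (prime_of_mem_freqSupp hp).one_le
    rw [hA]
    exact this
  -- the two sieves
  set β₀ : ℤ → ℝ := fun m => betaR H R m with hβ₀
  set β : ℤ → ℝ := fun m => if ∃ h ∈ H, m + h = 0 then 0 else betaR H R m with hβ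
  have hexp : ∀ m : ℤ, (β₀ m : ℂ) = ∑ c ∈ T, betaCoeff H R c * e (freqVal c * m) := fun m =>
    betaR_eq_sum_filter_betaCoeff (H := H) m
  have hβ₀nn : ∀ m, 0 ≤ β₀ m := fun m => betaR_nonneg R m
  have hββ₀ : ∀ n ∈ Icc 1 N, 0 ≤ β n ∧ β n ≤ β₀ n := by
    intro n _
    rw [hβ, hβ₀]; simp only
    split_ifs
    · exact ⟨le_rfl, betaR_nonneg R n⟩
    · exact ⟨betaR_nonneg R n, le_rfl⟩
  have hβnn : ∀ n ∈ Icc 1 N, 0 ≤ β n := fun n hn => (hββ₀ n hn).1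
  -- the moment bound
  set Mm : ℝ := 4 * (k : ℝ) * Real.exp (((4 * k ^ 2 * s + (2 ^ (2 * s * k) - 1) : ℕ) : ℝ) *
    (Real.log (Real.log R) + 4)) with hMmdef
  have hMm1 : 1 ≤ Mm := one_le_moment_const hk hR _ (Nat.cast_nonneg _)
  have hmom : ∑ n ∈ Icc 1 N, β n ^ s ≤ Mm * N := by
    have h1 := sum_pow_beta_le hadm hk' hR2 hH hs
    rw [hcard] at h1
    refine le_trans (le_of_eq (Finset.sum_congr rfl fun n _ => by rw [hβ])) (h1.trans ?_)
    refine mul_le_mul_of_nonneg_right ?_ (Nat.cast_nonneg N)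
    have hG0 := selbergG_nonneg (H := H) R
    have hGs : selbergG H R ^ s ≤ Real.exp (4 * (k : ℝ) ^ 2 * (Real.log (Real.log R) + 4)) ^ s := by
      refine pow_le_pow_left₀ hG0 ?_ s
      have := selbergG_le_exp hadm hk' hR2
      rwa [hcard] at this
    calc 4 * (k : ℝ) * selbergG H R ^ s *
          Real.exp (((2 : ℝ) ^ (2 * s * k) - 1) * (Real.log (Real.log R) + 4))
        ≤ 4 * (k : ℝ) * Real.exp (4 * (k : ℝ) ^ 2 * (Real.log (Real.log R) + 4)) ^ s *
          Real.exp (((2 : ℝ) ^ (2 * s * k) - 1) * (Real.log (Real.log R) + 4)) := by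
          gcongr
      _ = Mm := by
          rw [hMmdef, ← Real.exp_nat_mul, mul_assoc (4 * (k : ℝ)), ← Real.exp_add]
          congr 2
          have h2 : ((2 ^ (2 * s * k) - 1 : ℕ) : ℝ) = (2 : ℝ) ^ (2 * s * k) - 1 := by
            rw [Nat.cast_sub Nat.one_le_two_pow]; push_cast; ring
          push_cast [h2]
          ring
  have hQN : (R ^ 2) ^ 2 ≤ N := by rw [← pow_mul]; exact hRN
  -- the set estimate for `β`
  have hset' : ∀ (B : Finset ℕ) (f : ℕ → ℂ), B ⊆ range N → (∀ b, ‖f b‖ ≤ 1) →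
      (∀ b ∉ B, f b = 0) →
      ∑ n ∈ Icc 1 N, ‖∑ b ∈ range N, f b * e ((b : ℝ) * n / N)‖ ^ 2 * β n ≤
        (C * A) * N * (B.card : ℝ) ^ (1 + 3 * ε) := fun B f hB hf hfB =>
    hset T freqVal freqDen (betaCoeff H R) A (R ^ 2) hA1 hqd hθ hsep hw β₀ β hexp hβ₀nn s Mm hN hQN
      hεs hs hMm1 hMm hββ₀ hmom B f hB hf hfB
  -- dyadic pigeonhole, duality, integration
  set K : ℝ := 2 ^ (q * (1 + 3 * ε) / 2) / (1 - 2 ^ (q * (1 + 3 * ε) / 2 - 1)) with hK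
  have hCA : 0 < C * A := mul_pos hC (by linarith)
  have hres : ∀ f : ℕ → ℂ, ∑ n ∈ Icc 1 N, ‖∑ b ∈ range N, f b * e ((b : ℝ) * n / N)‖ ^ 2 * β n ≤
      (C * A * K ^ 2) * N * (∑ b ∈ range N, ‖f b‖ ^ q) ^ (2 / q) := fun f => by
    have := restriction_lq_of_set_estimate (N := N) β hβnn hCA hε.le hq1 hqε hset' f
    rw [hK]; linarith
  have hext := fun a : ℕ → ℂ =>
    extension_of_restriction hN0 β hβnn (by positivity : 0 ≤ C * A * K ^ 2) hp1 hq0 hpq hres a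
  have hfinal := Lp_extension_of_extension hN0 β (Real.sqrt_nonneg _) hp0 hext u
  rw [hβ] at hfinal
  simp only at hfinal
  convert hfinal using 3

/-! ### The named fact -/

/-- **Discharge of the named fact** `GreenTao2006_envelopingSieve_extension` (Green–Tao 2006,
Prop. 3.1 (i) with Prop. 4.2, monic-tuple case): for every `k ≥ 1` and `p > 2` there are
`c, C > 0`, `R₀, N₀` such that for every admissible `k`-tuple `H ⊆ [-N, N]`, `N ≥ N₀`,
`R ≥ R₀`, `R^{10} ≤ N`, the sieve `β = β_R · 1[F(n) ≠ 0]` (with `β_R` the Ramaré–Ruzsa /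
Green–Tao enveloping sieve of level `R` for `F(n) = ∏_{h ∈ H}(n+h)`) is nonnegative, is
`≥ c (log R)^k/𝔖(H)` on `X_{R!}`, and satisfies the `L^p(𝕋)` extension estimate.
[cite: GreenTao2006Restriction, Prop. 3.1 (i) and Prop. 4.2] -/
theorem _root_.Literature.NumberTheory.Sieve.GreenTao2006_envelopingSieve_extension_holds :
    GreenTao2006_envelopingSieve_extension := by
  intro k p hk hp
  -- exponents
  set q : ℝ := p / (p - 1) with hq
  have hp1 : 0 < p - 1 := by linarith
  have hq1 : 1 < q := by rw [hq, one_lt_div hp1]; linarith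
  have hq2 : q < 2 := by rw [hq, div_lt_iff₀ hp1]; linarith
  have hpq : (p - 1) * q = p := by rw [hq]; field_simp
  set ε : ℝ := min (1 / 4) ((2 / q - 1) / 6) with hε
  have hq0 : 0 < q := by linarith
  have h2q : 0 < 2 / q - 1 := by rw [sub_pos, lt_div_iff₀ hq0]; linarith
  have hε0 : 0 < ε := lt_min (by norm_num) (by positivity)
  have hε1 : ε ≤ 1 := (min_le_left _ _).trans (by norm_num)
  have hqε : q * (1 + 3 * ε) < 2 := by
    have h1 : ε ≤ (2 / q - 1) / 6 := min_le_right _ _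
    have h2 : q * (3 * ε) ≤ (2 - q) / 2 := by
      have : q * (3 * ((2 / q - 1) / 6)) = (2 - q) / 2 := by field_simp; ring
      rw [← this]
      exact mul_le_mul_of_nonneg_left (by linarith) hq0.le
    nlinarith
  set s : ℕ := ⌈1 / ε⌉₊ with hs
  have hs1 : 1 ≤ s := by rw [hs, Nat.one_le_ceil_iff]; positivity
  have hεs : 1 ≤ ε * s := by
    have : 1 / ε ≤ s := Nat.le_ceil _
    rwa [div_le_iff₀ hε0, mul_comm] at this
  -- constants
  obtain ⟨C, hC, hset⟩ := restriction_set_estimate hε0 hε1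
  obtain ⟨cG, hcG, R₁, hG⟩ := selbergG_ge k hk
  obtain ⟨N₁, hN₁⟩ := moment_const_sq_le k s hk
  set A : ℝ := (32 * (k : ℝ) ^ 2) ^ (⌊(32 * (k : ℝ) ^ 2) ^ (1 / ε)⌋₊ + 1) with hA
  set K : ℝ := 2 ^ (q * (1 + 3 * ε) / 2) / (1 - 2 ^ (q * (1 + 3 * ε) / 2 - 1)) with hK
  set Cfin : ℝ := Real.sqrt (C * A * K ^ 2) with hCfin
  have hL1 : (1 : ℝ) ≤ 32 * (k : ℝ) ^ 2 := by
    have : (1 : ℝ) ≤ k := by exact_mod_cast hk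
    nlinarith
  have hA1 : 1 ≤ A := one_le_pow₀ hL1
  have hK0 : 0 < K := by
    rw [hK]
    refine div_pos (Real.rpow_pos_of_pos two_pos _) ?_
    rw [sub_pos]
    exact Real.rpow_lt_one_of_one_lt_of_neg one_lt_two (by linarith)
  have hCfin : 0 < Cfin := Real.sqrt_pos.2 (by positivity)
  refine ⟨cG, Cfin, max R₁ 3, max N₁ 16, hcG, hCfin, ?_⟩
  intro H N R hcard hadm hH hN hR hRN
  have hR3 : 3 ≤ R := (le_max_right _ _).trans hR
  have hR₁ : R₁ ≤ R := (le_max_left _ _).trans hR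
  have hN16 : 16 ≤ N := (le_max_right _ _).trans hN
  have hNN₁ : N₁ ≤ N := (le_max_left _ _).trans hN
  have hRN10 : R ^ 10 ≤ N := by exact_mod_cast hRN
  have hR1 : 1 ≤ R := by omega
  have hRleN : R ≤ N := le_trans (by
    calc R = R ^ 1 := (pow_one R).symm
      _ ≤ R ^ 10 := Nat.pow_le_pow_right hR1 (by norm_num)) hRN10
  have hR4N : R ^ 4 ≤ N := le_trans (Nat.pow_le_pow_right hR1 (by norm_num)) hRN10
  have hMm := hN₁ N R hNN₁ hR3 hRleN
  refine ⟨fun m => if ∃ h ∈ H, m + h = 0 then 0 else betaR H R m, ?_, ?_, ?_⟩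
  · intro n
    simp only
    split_ifs
    · exact le_rfl
    · exact betaR_nonneg R n
  · intro n hn
    have hroot : ¬ ∃ h ∈ H, n + h = 0 := by
      rintro ⟨h, hh, h0⟩
      exact hn 2 Nat.prime_two (by omega) h hh (by rw [h0]; exact dvd_zero _)
    simp only [hroot, if_false]
    rw [betaR_eq_selbergG hadm hR1 hn]
    exact hG H R hcard hadm hR₁
  · intro u
    have := lp_bound_beta hk hcard hadm hp hpq hq1.le hε0 hqε hs1 hεs hC
      (fun {ι} => hset (ι := ι)) hR3 hR4N hN16 hH hMm u
    exact this

end GreenTao2006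

end Literature.NumberTheory.Sieve
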